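import Summits.KontsevichZagierPeriods.KontsevichZagierPeriods.Theorems.TerasomaMultiplicationMultiplicationAccessibleDoubling

/-!
# `MultiplicationAccessible` (stmt-KontsevichZagierPeriods-12305), line `shifted-family-prime-sieve`:
the LIOUVILLE GLUE — shifted family = Liouville identity `(♦)` + the unshifted crux, cancellation-free

Fibring the shifted box `[(0,1)^n, ∏_(k<n) t_k^(x+k/n−1)(1−t_k)^(s−1)]` over `z = (∏ t_k)^(1/n)` makes `x` a
spectator: `∏_(k<n) B(x+k/n, s) = ∫₀¹ n z^(nx−1) Ψ(z) dz`, and Gauss multiplication for all `x` is the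
rank-one statement `Ψ(z) = Ψ(0)(1−z)^(ns−1)`, `Ψ(0) = ∏_(k=1)^m B(k/n, s)` (Liouville's 1855 mechanism,
Andrews–Askey–Roy 1999, pp. 30–31, transplanted to Beta boxes; worker report of lead c2, idea card
`liouville-rotation-flow`). As an equivalence of two `n`-dimensional Beta boxes this is

  `(♦)  [(0,1)^n, ∏_(k<n) t_k^(x+k/n−1)(1−t_k)^(s−1)] ∼ [(0,1)^n, n·z₀^(nx−1)(1−z₀)^(ns−1) ∏_(j<m) z_(j+1)^((j+1)/n−1)(1−z_(j+1))^(s−1)]`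

(value identity `∏_(k<n) B(x+k/n,s) = n·B(nx,ns)·∏_(k=1)^m B(k/n,s)`, true by Gauss). This file proves the
book-keeping, sorry-free: **`(♦)` at `n = m+1` (all `x, s`) and the crux instances `At m s` (all `s`) give
the shifted family `GM(m; x, s)` for all `x, s`** (`gm_of_liouville_of_at`), with NO cancellation — in the
formal period ring `(♦)` reads `⟦1⟧∏ g(x+k/n,s) = ⟦n⟧ g(nx,ns) L_C(s)` and `At m s` reads
`L_C(s) = ⟦n^(ns−1)⟧ ∏ g(s,(j+1)s)` (`Doubling.at_iff_prod_eq`), whose product is `GM` after `m`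
reflections. Hence the line's residual at a prime `p` splits faithfully into `(♦)_p` (a real Stokes
statement in dimension `p + 1`) and the unshifted crux at `p` (landed for `p = 3`: `at_two`).
References: Andrews–Askey–Roy 1999 Thm 1.5.2 and pp. 30–31; Kontsevich–Zagier 2001 §1.2.
-/

noncomputable section

open MeasureTheory Set Finset
open scoped BigOperators
open Literature.NumberTheory.Transcendental
open Literature.NumberTheory.Transcendental.KZ
open Summit.KontsevichZagierPeriods.MultiplicationAccessible.Negative (boxDom At)

namespace Summit.KontsevichZagierPeriods.TerasomaMultiplication.MultiplicationAccessible

namespace Liouville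

/-- Splitting off coordinate `0` of a Beta product with exponent vectors `(W, 1/n, 2/n, …)` and
`(W', s, …, s)` (written with `if (k:ℕ) = 0`). [folklore] -/
theorem prod_ite_succ (m : ℕ) (W W' s : ℚ) (z : Fin (m + 1) → ℝ) :
    ∏ k : Fin (m + 1), ((z k) ^ (((if (k : ℕ) = 0 then W else (k : ℚ) / ((m : ℚ) + 1) : ℚ) : ℝ) - 1) *
        (1 - z k) ^ (((if (k : ℕ) = 0 then W' else s : ℚ) : ℝ) - 1)) =
      (z 0) ^ ((W:ℝ) - 1) * (1 - z 0) ^ ((W':ℝ) - 1) *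
        ∏ j : Fin m, ((z j.succ) ^ ((((j:ℕ):ℝ) + 1) / ((m:ℝ) + 1) - 1) *
          (1 - z j.succ) ^ ((s:ℝ) - 1)) := by
  rw [Fin.prod_univ_succ]
  simp only [Fin.val_zero, Fin.val_succ, Nat.add_eq_zero_iff, one_ne_zero, and_false,
    ↓reduceIte]
  push_cast
  ring

/-- The right integrand of `(♦)`: Beta-box spelling (constant `n`, exponent vectors
`(nx, 1/n, 2/n, …)` and `(ns, s, …, s)`) equals the pinned spelling. [folklore] -/
theorem right_eq (m : ℕ) (x s : ℚ) (z : Fin (m + 1) → ℝ) :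
    ((m:ℝ) + 1) *
        ∏ i : Fin (m + 1), ((z i) ^ ((((if (i : ℕ) = 0 then ((m : ℚ) + 1) * x
            else (i : ℚ) / ((m : ℚ) + 1) : ℚ)) : ℝ) - 1) *
          (1 - z i) ^ ((((if (i : ℕ) = 0 then ((m : ℚ) + 1) * s else s : ℚ)) : ℝ) - 1)) =
      ((m:ℝ) + 1) *
        ((z 0) ^ (((m:ℝ) + 1) * (x:ℝ) - 1) * (1 - z 0) ^ (((m:ℝ) + 1) * (s:ℝ) - 1)) *
        ∏ j : Fin m, (z j.succ) ^ ((((j:ℕ):ℝ) + 1) / ((m:ℝ) + 1) - 1) *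
          (1 - z j.succ) ^ ((s:ℝ) - 1) := by
  rw [prod_ite_succ m (((m:ℚ) + 1) * x) (((m:ℚ) + 1) * s) s z]
  push_cast
  ring

/-- The constant `n` of `(♦)` is real algebraic. [folklore] -/
theorem isAlgebraic_natSucc (m : ℕ) : IsAlgebraic ℚ ((m:ℝ) + 1) := by
  have := isAlgebraic_nat (R := ℚ) (A := ℝ) (m + 1)
  push_cast at this
  exact this

/-- **`(♦)` in `P`**: the pinned Liouville identity at `(m, x, s)` gives
`⟦[pt,1]⟧ ∏_(k≤m) g(x + k/(m+1), s) = ⟦[pt, m+1]⟧ ∏_k g(α″_k, β″_k)` with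
`(α″, β″) = (((m+1)x, 1/(m+1), 2/(m+1), …), ((m+1)s, s, …, s))` (the two Beta boxes of
`MultGlue.exists_betaRep`, the pinned hypothesis applied to them, `MultGlue.prod_eq_of_equiv`).
[cite: AndrewsAskeyRoy1999, Thm 1.5.2] -/
theorem prod_eq_of_pinned {B : ℚ → ℚ → IntegralRep 1}
    (hB : ∀ p q, 0 < p → 0 < q → (B p q).domain = {t | t 0 ∈ Set.Ioo (0:ℝ) 1} ∧
      (B p q).integrand = fun t => (t 0) ^ ((p:ℝ) - 1) * (1 - t 0) ^ ((q:ℝ) - 1))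
    (m : ℕ) {x s : ℚ} (hx : 0 < x) (hs : 0 < s)
    (h : ∀ (r r' : IntegralRep (m + 1)),
        r.domain = {z | ∀ i, z i ∈ Set.Ioo (0:ℝ) 1} →
        Set.EqOn r.integrand (fun z => ∏ k : Fin (m + 1),
          (z k) ^ ((x:ℝ) + ((k:ℕ):ℝ) / ((m:ℝ) + 1) - 1) * (1 - z k) ^ ((s:ℝ) - 1)) r.domain →
        r'.domain = {z | ∀ i, z i ∈ Set.Ioo (0:ℝ) 1} →
        Set.EqOn r'.integrand (fun z => ((m:ℝ) + 1) *
          ((z 0) ^ (((m:ℝ) + 1) * (x:ℝ) - 1) * (1 - z 0) ^ (((m:ℝ) + 1) * (s:ℝ) - 1)) *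
          ∏ j : Fin m, (z j.succ) ^ ((((j:ℕ):ℝ) + 1) / ((m:ℝ) + 1) - 1) *
            (1 - z j.succ) ^ ((s:ℝ) - 1)) r'.domain →
        Equivalent r r') :
    toFormalPeriod (of (IntegralRep.unit.constMul (1:ℝ) isAlgebraic_one)) *
        ∏ k : Fin (m + 1), toFormalPeriod (of (B (x + (k : ℚ) / ((m : ℚ) + 1)) s)) =
      toFormalPeriod (of (IntegralRep.unit.constMul ((m:ℝ) + 1) (isAlgebraic_natSucc m))) *
        ∏ k : Fin (m + 1), toFormalPeriod (of (B
          (if (k : ℕ) = 0 then ((m : ℚ) + 1) * x else (k : ℚ) / ((m : ℚ) + 1))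
          (if (k : ℕ) = 0 then ((m : ℚ) + 1) * s else s))) := by
  have hαpos : ∀ k : Fin (m + 1), 0 < x + (k : ℚ) / ((m : ℚ) + 1) := fun k => by positivity
  have hα'pos : ∀ k : Fin (m + 1),
      0 < (if (k : ℕ) = 0 then ((m : ℚ) + 1) * x else (k : ℚ) / ((m : ℚ) + 1)) := fun k => by
    split_ifs with hk
    · positivity
    · exact div_pos (Nat.cast_pos.mpr (Nat.pos_of_ne_zero hk)) (by positivity)
  have hβ'pos : ∀ k : Fin (m + 1), 0 < (if (k : ℕ) = 0 then ((m : ℚ) + 1) * s else s) :=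
    fun k => by split_ifs <;> positivity
  refine MultGlue.prod_eq_of_equiv hB isAlgebraic_one (isAlgebraic_natSucc m) hαpos (fun _ => hs)
    hα'pos hβ'pos ?_
  obtain ⟨ρ₁, h₁d, h₁i⟩ := MultGlue.exists_betaRep (N := m + 1) (1:ℝ) isAlgebraic_one
    (fun k => x + (k : ℚ) / ((m : ℚ) + 1)) (fun _ => s) hαpos (fun _ => hs)
  obtain ⟨ρ₂, h₂d, h₂i⟩ := MultGlue.exists_betaRep (N := m + 1) ((m:ℝ) + 1) (isAlgebraic_natSucc m)
    (fun k => if (k : ℕ) = 0 then ((m : ℚ) + 1) * x else (k : ℚ) / ((m : ℚ) + 1))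
    (fun k => if (k : ℕ) = 0 then ((m : ℚ) + 1) * s else s) hα'pos hβ'pos
  refine ⟨ρ₁, ρ₂, ⟨h₁d, h₁i⟩, ⟨h₂d, h₂i⟩, h ρ₁ ρ₂ h₁d (fun z hz => ?_) h₂d (fun z hz => ?_)⟩
  · exact (h₁i hz).trans (GlueFromParts.gmLeft_eq m x s z)
  · exact (h₂i hz).trans (right_eq m x s z)

/-- **`(♦)` and the crux instance give `GM` in `P`**: from
`⟦1⟧ ∏_k g(x + k/n, s) = ⟦n⟧ g(nx,ns) ∏_(i<m) g((i+1)/n, s)` (`(♦)`), the instance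
`∏_(i<m) g((i+1)/n, s) = ⟦n^(ns−1)⟧ ∏_(j<m) g(s,(j+1)s)` (`At m s`, `Doubling.at_iff_prod_eq`) and
`m` reflections, `⟦1⟧ ∏_k g(x + k/n, s) = ⟦n^(ns)⟧ g(nx,ns) ∏_(j<m) g((j+1)s, s)` — the shifted
family `GM(m; x, s)` in `P`, cancellation-free. [cite: AndrewsAskeyRoy1999, Thm 1.5.2] -/
theorem gm_prod_eq {B : ℚ → ℚ → IntegralRep 1}
    (hB : ∀ p q, 0 < p → 0 < q → (B p q).domain = {t | t 0 ∈ Set.Ioo (0:ℝ) 1} ∧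
      (B p q).integrand = fun t => (t 0) ^ ((p:ℝ) - 1) * (1 - t 0) ^ ((q:ℝ) - 1))
    (m : ℕ) {x s : ℚ} (hs : 0 < s)
    (hL : toFormalPeriod (of (IntegralRep.unit.constMul (1:ℝ) isAlgebraic_one)) *
        ∏ k : Fin (m + 1), toFormalPeriod (of (B (x + (k : ℚ) / ((m : ℚ) + 1)) s)) =
      toFormalPeriod (of (IntegralRep.unit.constMul ((m:ℝ) + 1) (isAlgebraic_natSucc m))) *
        ∏ k : Fin (m + 1), toFormalPeriod (of (B
          (if (k : ℕ) = 0 then ((m : ℚ) + 1) * x else (k : ℚ) / ((m : ℚ) + 1))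
          (if (k : ℕ) = 0 then ((m : ℚ) + 1) * s else s))))
    (hAt : At m s) :
    toFormalPeriod (of (IntegralRep.unit.constMul (1:ℝ) isAlgebraic_one)) *
        ∏ k : Fin (m + 1), toFormalPeriod (of (B (x + (k : ℚ) / ((m : ℚ) + 1)) s)) =
      toFormalPeriod (of (IntegralRep.unit.constMul (((m:ℝ) + 1) ^ (((m:ℝ) + 1) * (s:ℝ)))
        (MultGlue.isAlgebraic_gaussConst m s))) *
        ∏ k : Fin (m + 1), toFormalPeriod (of (B
          (if (k : ℕ) = 0 then ((m : ℚ) + 1) * x else (k : ℚ) * s)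
          (if (k : ℕ) = 0 then ((m : ℚ) + 1) * s else s))) := by
  have hC := (Doubling.at_iff_prod_eq hB m s hs).mp hAt
  have reflD : ∏ j : Fin m, toFormalPeriod (of (B s ((((j:ℕ):ℚ) + 1) * s))) =
      ∏ j : Fin m, toFormalPeriod (of (B ((((j:ℕ):ℚ) + 1) * s) s)) :=
    Finset.prod_congr rfl fun j _ => Doubling.refl_eq hB hs (by positivity)
  -- split coordinate `0` off both right-hand products
  have hR₁ : ∏ k : Fin (m + 1), toFormalPeriod (of (B
        (if (k : ℕ) = 0 then ((m : ℚ) + 1) * x else (k : ℚ) / ((m : ℚ) + 1))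
        (if (k : ℕ) = 0 then ((m : ℚ) + 1) * s else s))) =
      toFormalPeriod (of (B (((m:ℚ) + 1) * x) (((m:ℚ) + 1) * s))) *
        ∏ i : Fin m, toFormalPeriod (of (B ((((i:ℕ):ℚ) + 1) / ((m:ℚ) + 1)) s)) := by
    rw [Fin.prod_univ_succ]
    simp [Fin.val_succ]
  have hR₂ : ∏ k : Fin (m + 1), toFormalPeriod (of (B
        (if (k : ℕ) = 0 then ((m : ℚ) + 1) * x else (k : ℚ) * s)
        (if (k : ℕ) = 0 then ((m : ℚ) + 1) * s else s))) =
      toFormalPeriod (of (B (((m:ℚ) + 1) * x) (((m:ℚ) + 1) * s))) *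
        ∏ j : Fin m, toFormalPeriod (of (B ((((j:ℕ):ℚ) + 1) * s) s)) := by
    rw [Fin.prod_univ_succ]
    simp [Fin.val_succ]
  -- the constants `n · n^(ns−1) = n^(ns)`
  have hconst : toFormalPeriod (of (IntegralRep.unit.constMul ((m:ℝ) + 1) (isAlgebraic_natSucc m))) *
      toFormalPeriod (of (IntegralRep.unit.constMul (((m:ℝ) + 1) ^ (((m:ℝ) + 1) * s - 1))
        (isAlgebraic_gaussMultConst m s))) =
      toFormalPeriod (of (IntegralRep.unit.constMul (((m:ℝ) + 1) ^ (((m:ℝ) + 1) * (s:ℝ)))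
        (MultGlue.isAlgebraic_gaussConst m s))) := by
    rw [← MultGlue.ptConst_mul (isAlgebraic_natSucc m) (isAlgebraic_gaussMultConst m s)
      ((isAlgebraic_natSucc m).mul (isAlgebraic_gaussMultConst m s))]
    refine MultGlue.ptConst_congr _ _ ?_
    have hn : (0:ℝ) < (m:ℝ) + 1 := by positivity
    rw [Real.rpow_sub_one hn.ne', mul_div_cancel₀ _ hn.ne']
  rw [hL, hR₁, hC, hR₂, reflD, ← hconst]
  ring

end Liouville

/-- **The Liouville glue** (no cancellation): if the Liouville identity `(♦)` holds at `n = m + 1`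
for all rational `x, s > 0` — every box representation of `∏_(k<n) B(x+k/n, s)` is equivalent to every
box representation of `n·B(nx, ns)·∏_(k=1)^m B(k/n, s)` — and the crux instance `At m s` holds for
every rational `s > 0`, then the shifted Gauss multiplication `GM(m; x, s)` holds inside the rules for
all rational `x, s > 0` (`Liouville.prod_eq_of_pinned`, `Liouville.gm_prod_eq`,
`MultGlue.equiv_of_prod_eq`, `MultGlue.equivalent_of_equiv`). With the Sieve this splits the line's
residual at each odd prime `p` into `(♦)_p` and the unshifted crux at `p`.
[cite: AndrewsAskeyRoy1999, Thm 1.5.2] -/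
theorem gm_of_liouville_of_at :
    ∀ (m : ℕ), (∀ (x s : ℚ), 0 < x → 0 < s → ∀ (r r' : KZ.IntegralRep (m + 1)),
        r.domain = {z | ∀ i, z i ∈ Set.Ioo (0:ℝ) 1} →
        Set.EqOn r.integrand (fun z => ∏ k : Fin (m + 1),
          (z k) ^ ((x:ℝ) + ((k:ℕ):ℝ) / ((m:ℝ) + 1) - 1) * (1 - z k) ^ ((s:ℝ) - 1)) r.domain →
        r'.domain = {z | ∀ i, z i ∈ Set.Ioo (0:ℝ) 1} →
        Set.EqOn r'.integrand (fun z => ((m:ℝ) + 1) *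
          ((z 0) ^ (((m:ℝ) + 1) * (x:ℝ) - 1) * (1 - z 0) ^ (((m:ℝ) + 1) * (s:ℝ) - 1)) *
          ∏ j : Fin m, (z j.succ) ^ ((((j:ℕ):ℝ) + 1) / ((m:ℝ) + 1) - 1) *
            (1 - z j.succ) ^ ((s:ℝ) - 1)) r'.domain →
        KZ.Equivalent r r') →
      (∀ s : ℚ, 0 < s → Summit.KontsevichZagierPeriods.MultiplicationAccessible.Negative.At m s) →
      ∀ (x s : ℚ), 0 < x → 0 < s → ∀ (r r' : KZ.IntegralRep (m + 1)),
        r.domain = {z | ∀ i, z i ∈ Set.Ioo (0:ℝ) 1} →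
        Set.EqOn r.integrand (fun z => ∏ k : Fin (m + 1),
          (z k) ^ ((x:ℝ) + ((k:ℕ):ℝ) / ((m:ℝ) + 1) - 1) * (1 - z k) ^ ((s:ℝ) - 1)) r.domain →
        r'.domain = {z | ∀ i, z i ∈ Set.Ioo (0:ℝ) 1} →
        Set.EqOn r'.integrand (fun z => ((m:ℝ) + 1) ^ (((m:ℝ) + 1) * (s:ℝ)) *
          ((z 0) ^ (((m:ℝ) + 1) * (x:ℝ) - 1) * (1 - z 0) ^ (((m:ℝ) + 1) * (s:ℝ) - 1)) *
          ∏ j : Fin m, (z j.succ) ^ ((((j:ℕ):ℝ) + 1) * (s:ℝ) - 1) * (1 - z j.succ) ^ ((s:ℝ) - 1))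
          r'.domain →
        KZ.Equivalent r r' := by
  intro m hLiou hAt x s hx hs r r' hr hri hr' hri'
  obtain ⟨B, hB⟩ := MultGlue.exists_betaFamily
  have hP := Liouville.gm_prod_eq hB m hs
    (Liouville.prod_eq_of_pinned hB m hx hs (hLiou x s hx hs)) (hAt s hs)
  have hex := MultGlue.equiv_of_prod_eq hB isAlgebraic_one (MultGlue.isAlgebraic_gaussConst m s)
    (α := fun k : Fin (m + 1) => x + (k : ℚ) / ((m : ℚ) + 1)) (β := fun _ => s)
    (α' := fun k : Fin (m + 1) => if (k : ℕ) = 0 then ((m : ℚ) + 1) * x else (k : ℚ) * s)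
    (β' := fun k : Fin (m + 1) => if (k : ℕ) = 0 then ((m : ℚ) + 1) * s else s)
    (fun k => by positivity) (fun _ => hs)
    (fun k => by split_ifs with h; exacts [by positivity, MultGlue.natCast_mul_pos h hs])
    (fun k => by split_ifs <;> positivity) hP
  exact MultGlue.equivalent_of_equiv hex r r' hr
    (fun z hz => (hri hz).trans (GlueFromParts.gmLeft_eq m x s z).symm) hr'
    (fun z hz => (hri' hz).trans (GlueFromParts.gmRight_eq m x s z).symm)

end Summit.KontsevichZagierPeriods.TerasomaMultiplication.MultiplicationAccessible

end
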